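import Summits.QuantumFields.YangMills.Theorems.AllWindowsColdBoxBoxHighLineStep2Defs
import Summits.QuantumFields.YangMills.Theorems.AllWindowsColdBoxBoxHighLineLandauCirculation
import Summits.QuantumFields.YangMills.Theorems.AllWindowsColdBoxBoxHighLineLaplaceSandwichPauliFlat
import Literature.MathematicalPhysics.QuantumLattice.LatticeGaugeDLRGibbsProofs
import Literature.MathematicalPhysics.QuantumFieldTheory.Balaban1983to89.B10Eq18ChangeOfVariables
import Mathlib
import HarnessLib

/-!
# TASK T-S5.14 `BoxStateEdgeChart` BY NAME — the cold-box state in the edge chart (planner ym-idea-2 g18,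
# `Cruxes/BoxHighWindowsSU22/TaskS5Step2Defs.lean`, `STUB-PLAN-S5-STEP2.md` §2/§6; LINE-19 ⟨stmt-QuantumFields-24004⟩)

Free-hands measure plumbing of width seat `ym-line-sfw-p2-w3` (g39, cell `ym-idea-1`): for every `boxState`-integrable `F`,

  `∫ F dboxState β H = (∫_{chartDomain} F(U(a)) e^{−β S(U(a))} Π_e σ(‖a_e‖) da) / (∫_{chartDomain} e^{−β S(U(a))} Π_e σ(‖a_e‖) da)`,

`U(a) = edgeChart H a`.  Route: `boxState` is by definition the `−β S`-tilt (Mathlib `Measure.tilted`) of the glued product Haar measure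
`boxHaar H` of the box edges (cold wall `1` outside); the product Haar measure is the push-forward of the product chart law `Π σ(A)dA`
(✓`B10Eq18SigmaSU2Haar.map_pi_expPauli`), which is Lebesgue measure on the product of the `π`-balls with density `Π σ`
(✓`B10Eq18ChangeOfVariables.pi_sigmaMeasure_eq`); re-indexing the box edges by the free variables `LandauFree H`
(`freeEquiv`, ✓`mem_boxEdgesAt_of_mem_boxEdges`, Mathlib `volume_measurePreserving_piCongrLeft`) and gluing (`glueWith_expPauli_chartReindex`)
identify this with the push-forward of the chart measure under `edgeChart H` — **`map_edgeChart_chartMeasure`** — whence the integral formula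
`integral_boxHaar_eq_chart` for every a.e.-strongly measurable integrand, and ★`boxStateEdgeChart` by `integral_tilted`
(the `Integrable F` hypothesis of the task Prop gives a.e.-strong measurability for `boxHaar` through `absolutelyContinuous_tilted`).

Mathlib + tree only; no `sorry`.  HONEST LABEL: measure plumbing (one S/M brick of STEP 2); S5 (`stub_landauSecondOrder`), U5,
⟨stmt-QuantumFields-24004⟩ ⟨24335⟩ ⟨24336⟩ remain OPEN; no crux, rung or summit is proved; the Yang–Mills mass gap is NOT proved by this file.
-/

set_option autoImplicit false

noncomputable section

open MeasureTheory Matrix Finset Real Metric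
open scoped ENNReal
open Literature.MathematicalPhysics.QuantumFieldTheory (haarProbability)
open Literature.MathematicalPhysics.QuantumFieldTheory.AxialGauge (boxEdges)
open Literature.MathematicalPhysics.QuantumFieldTheory.LatticeMaxwell (boxEdgesAt)
open Literature.MathematicalPhysics.QuantumFieldTheory.Balaban1983to89.B10Eq18SigmaSU2Haar
  (expPauli expPauli_zero measurable_expPauli sigmaMeasure map_pi_expPauli measurePreserving_pi_expPauli measurable_sigmaSU2_norm)
open Literature.MathematicalPhysics.QuantumFieldTheory.Balaban1983to89.B10Eq22Rescaling (sigmaSU2)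
open Literature.MathematicalPhysics.QuantumFieldTheory.Balaban1983to89.B10Eq18ChangeOfVariables (pi_sigmaMeasure_eq)
open Literature.MathematicalPhysics.QuantumLattice (gaugeTransformZd LGConfig ZdEdge wilsonBoundaryAction fundamentalRep ymSpecification
  continuous_wilsonBoundaryAction exists_bound_of_continuous integrable_of_bound continuous_fundamentalRep)
open Literature.Probability.LatticeModels (Site glueWith glueWith_apply_mem glueWith_apply_not_mem measurable_glueWith)
open Summit.QuantumFields.YangMills.Theorems.WeakCouplingRates (boxState dirCorner)

namespace Summit.QuantumFields.YangMills.Theorems.AllWindowsColdBoxBoxHighLine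

namespace EdgeChart

/-! ## Re-indexing the box edges by the free variables -/

/-- The box edges ARE the free variables: `↥(boxEdges 4 (2H+1)) ≃ LandauFree H` (✓`mem_boxEdgesAt_of_mem_boxEdges`). [problem-side definition] -/
def freeEquiv (H : ℕ) : ↥(boxEdges 4 (2 * H + 1)) ≃ LandauFree H where
  toFun e := ⟨⟨e.1, mem_boxEdgesAt_of_mem_boxEdges e.2⟩, not_not_intro e.2⟩
  invFun e := ⟨e.1.1, not_not.1 e.2⟩
  left_inv _ := rfl
  right_inv _ := rfl

/-- Re-indexing of chart variables along `freeEquiv`: `(chartReindex H a) b = a (freeEquiv H b)`. [problem-side definition] -/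
def chartReindex (H : ℕ) : (LandauFree H → E3) ≃ᵐ (↥(boxEdges 4 (2 * H + 1)) → E3) :=
  (MeasurableEquiv.piCongrLeft (fun _ => E3) (freeEquiv H)).symm

/-- Evaluation of `chartReindex`. -/
theorem chartReindex_apply (H : ℕ) (a : LandauFree H → E3) (b : ↥(boxEdges 4 (2 * H + 1))) :
    chartReindex H a b = a (freeEquiv H b) := rfl

/-- `chartReindex` preserves Lebesgue measure. -/
theorem measurePreserving_chartReindex (H : ℕ) :
    MeasurePreserving (chartReindex H) (volume : Measure (LandauFree H → E3)) (volume : Measure (↥(boxEdges 4 (2 * H + 1)) → E3)) :=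
  (MeasureTheory.volume_measurePreserving_piCongrLeft (fun _ => E3) (freeEquiv H)).symm _

/-- **Gluing the re-indexed exponential chart with the cold wall IS the edge chart**:
`glueWith Λ (expPauli ∘ chartReindex H a) 1 = edgeChart H a`. -/
theorem glueWith_expPauli_chartReindex (H : ℕ) (a : LandauFree H → E3) :
    glueWith (boxEdges 4 (2 * H + 1)) (fun b => expPauli (chartReindex H a b)) (fun _ => (1 : SU2)) = edgeChart H a := by
  funext x
  show _ = expPauli (freeVec H a x)
  unfold freeVec
  by_cases hx : x ∈ boxEdges 4 (2 * H + 1)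
  · rw [glueWith_apply_mem _ _ _ hx, chartReindex_apply, dif_pos (mem_boxEdgesAt_of_mem_boxEdges hx), dif_pos hx]
    rfl
  · rw [glueWith_apply_not_mem _ _ _ hx]
    by_cases hx' : x ∈ boxEdgesAt dirCorner (2 * H + 3)
    · rw [dif_pos hx', dif_neg hx, expPauli_zero]
    · rw [dif_neg hx', expPauli_zero]

/-! ## Measurability and signs -/

/-- The zero extension `a ↦ freeVec H a e` is measurable (a coordinate projection or `0`). -/
theorem measurable_freeVec (H : ℕ) (e : ZdEdge 4) : Measurable fun a : LandauFree H → E3 => freeVec H a e := by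
  by_cases h : e ∈ boxEdgesAt dirCorner (2 * H + 3)
  · by_cases h' : e ∈ boxEdges 4 (2 * H + 1)
    · have : (fun a : LandauFree H → E3 => freeVec H a e) = fun a => a ⟨⟨e, h⟩, not_not_intro h'⟩ := by
        funext a; simp only [freeVec, dif_pos h, dif_pos h']
      rw [this]; exact measurable_pi_apply _
    · have : (fun a : LandauFree H → E3 => freeVec H a e) = fun _ => 0 := by
        funext a; simp only [freeVec, dif_pos h, dif_neg h']
      rw [this]; exact measurable_const
  · have : (fun a : LandauFree H → E3 => freeVec H a e) = fun _ => 0 := by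
      funext a; simp only [freeVec, dif_neg h]
    rw [this]; exact measurable_const

/-- The edge chart is measurable. -/
theorem measurable_edgeChart (H : ℕ) : Measurable (edgeChart H) :=
  measurable_pi_lambda _ fun e => measurable_expPauli.comp (measurable_freeVec H e)

/-- The Haar chart weight is measurable. -/
theorem measurable_chartHaarWeight (H : ℕ) : Measurable (chartHaarWeight H) := by
  unfold chartHaarWeight
  exact Finset.measurable_prod _ fun e _ => measurable_sigmaSU2_norm.comp (measurable_pi_apply e)

/-- The Haar chart weight is nonnegative. -/
theorem chartHaarWeight_nonneg (H : ℕ) (a : LandauFree H → E3) : 0 ≤ chartHaarWeight H a :=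
  Finset.prod_nonneg fun _ _ => LaplaceSandwich.sigmaSU2_nonneg _

/-! ## The two measures and the change of variables -/

/-- **The glued product Haar measure of the box edges** (cold wall `1` outside) — `boxState` before the `−β S` tilt. [problem-side definition] -/
def boxHaar (H : ℕ) : Measure (LGConfig 4 SU2) :=
  (Measure.pi fun _ : ↥(boxEdges 4 (2 * H + 1)) => haarProbability SU2).map
    (glueWith (boxEdges 4 (2 * H + 1)) · fun _ => (1 : SU2))

/-- **The chart measure**: Lebesgue measure on `chartDomain H` with density `Π_e σ(‖a_e‖)`. [problem-side definition] -/
def chartMeasure (H : ℕ) : Measure (LandauFree H → E3) :=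
  ((volume : Measure (LandauFree H → E3)).restrict (chartDomain H)).withDensity fun a => ENNReal.ofReal (chartHaarWeight H a)

/-- `boxState` IS the tilted `boxHaar` (definitional). -/
theorem boxState_eq_tilted (β : ℝ) (H : ℕ) :
    boxState (fundamentalRep (Fin 2)) β H = (boxHaar H).tilted fun U => -β * boxWilson H U := rfl

/-- `boxHaar` is a probability measure. -/
theorem isProbabilityMeasure_boxHaar (H : ℕ) : IsProbabilityMeasure (boxHaar H) :=
  Measure.isProbabilityMeasure_map (measurable_glueWith _ _).aemeasurable

/-- **The re-indexed chart measure is the product chart law `Π_b σ(A_b)dA_b`.** -/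
theorem map_chartReindex_chartMeasure (H : ℕ) :
    (chartMeasure H).map (chartReindex H) = Measure.pi fun _ : ↥(boxEdges 4 (2 * H + 1)) => sigmaMeasure := by
  rw [pi_sigmaMeasure_eq]
  have hD : chartDomain H = chartReindex H ⁻¹' Set.pi Set.univ fun _ : ↥(boxEdges 4 (2 * H + 1)) => ball (0 : E3) Real.pi := by
    ext a
    simp only [chartDomain, Set.mem_setOf_eq, Set.mem_preimage, Set.mem_univ_pi, mem_ball_zero_iff, chartReindex_apply]
    exact ⟨fun h b => h _, fun h e => by simpa using h ((freeEquiv H).symm e)⟩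
  have hw : ∀ a : LandauFree H → E3, ENNReal.ofReal (chartHaarWeight H a)
      = ∏ b : ↥(boxEdges 4 (2 * H + 1)), ENNReal.ofReal (sigmaSU2 ‖chartReindex H a b‖) := by
    intro a
    rw [chartHaarWeight, ENNReal.ofReal_prod_of_nonneg fun e _ => LaplaceSandwich.sigmaSU2_nonneg _]
    exact (Fintype.prod_equiv (freeEquiv H) (fun b => ENNReal.ofReal (sigmaSU2 ‖chartReindex H a b‖))
      (fun e => ENNReal.ofReal (sigmaSU2 ‖a e‖)) fun b => rfl).symm
  ext S hS
  rw [Measure.map_apply (chartReindex H).measurable hS, chartMeasure, withDensity_apply _ ((chartReindex H).measurable hS),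
    withDensity_apply _ hS, Measure.restrict_restrict ((chartReindex H).measurable hS), Measure.restrict_restrict hS, hD,
    ← Set.preimage_inter]
  simp_rw [hw]
  exact (measurePreserving_chartReindex H).setLIntegral_comp_preimage_emb (chartReindex H).measurableEmbedding
    (fun y => ∏ b : ↥(boxEdges 4 (2 * H + 1)), ENNReal.ofReal (sigmaSU2 ‖y b‖)) _

/-- ★ **THE CHANGE OF VARIABLES**: the push-forward of the chart measure under the edge chart is the glued product Haar measure. -/
theorem map_edgeChart_chartMeasure (H : ℕ) : (chartMeasure H).map (edgeChart H) = boxHaar H := by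
  have hcomp : edgeChart H = (glueWith (boxEdges 4 (2 * H + 1)) · fun _ => (1 : SU2)) ∘
      ((fun (A : ↥(boxEdges 4 (2 * H + 1)) → E3) (b : ↥(boxEdges 4 (2 * H + 1))) => expPauli (A b)) ∘ chartReindex H) := by
    funext a; exact (glueWith_expPauli_chartReindex H a).symm
  rw [hcomp, ← Measure.map_map (measurable_glueWith _ _) ((measurePreserving_pi_expPauli _).measurable.comp (chartReindex H).measurable),
    ← Measure.map_map (measurePreserving_pi_expPauli _).measurable (chartReindex H).measurable, map_chartReindex_chartMeasure,
    map_pi_expPauli]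
  rfl

/-- ★ **Integration against `boxHaar` in the chart**: for every a.e.-strongly measurable `g`,
`∫ g dboxHaar = ∫_{chartDomain} g(U(a)) Π_e σ(‖a_e‖) da`. -/
theorem integral_boxHaar_eq_chart (H : ℕ) (g : LGConfig 4 SU2 → ℝ) (hg : AEStronglyMeasurable g (boxHaar H)) :
    ∫ U, g U ∂(boxHaar H) = ∫ a in chartDomain H, g (edgeChart H a) * chartHaarWeight H a := by
  have hg' : AEStronglyMeasurable g ((chartMeasure H).map (edgeChart H)) := by rwa [map_edgeChart_chartMeasure]
  rw [← map_edgeChart_chartMeasure, integral_map (measurable_edgeChart H).aemeasurable hg', chartMeasure,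
    integral_withDensity_eq_integral_toReal_smul (measurable_chartHaarWeight H).ennreal_ofReal
      (Filter.Eventually.of_forall fun _ => ENNReal.ofReal_lt_top)]
  refine integral_congr_ae (Filter.Eventually.of_forall fun a => ?_)
  simp only [ENNReal.toReal_ofReal (chartHaarWeight_nonneg H a), smul_eq_mul, mul_comm]

/-- The Boltzmann factor `U ↦ e^{−β S(U)}` of the box is continuous. -/
theorem continuous_exp_boxWilson (β : ℝ) (H : ℕ) : Continuous fun U : LGConfig 4 SU2 => Real.exp (-β * boxWilson H U) :=
  Real.continuous_exp.comp (continuous_const.mul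
    (continuous_wilsonBoundaryAction (fundamentalRep (Fin 2)) (continuous_fundamentalRep (Fin 2)) (boxEdges 4 (2 * H + 1))))

/-- The Boltzmann factor is `boxHaar`-integrable (bounded and continuous on a compact configuration space). -/
theorem integrable_exp_boxWilson (β : ℝ) (H : ℕ) : Integrable (fun U : LGConfig 4 SU2 => Real.exp (-β * boxWilson H U)) (boxHaar H) := by
  haveI := isProbabilityMeasure_boxHaar H
  obtain ⟨C, hC⟩ := exists_bound_of_continuous (continuous_exp_boxWilson β H)
  exact integrable_of_bound (continuous_exp_boxWilson β H).aestronglyMeasurable hC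

/-- A `boxState`-integrable observable is a.e.-strongly measurable for `boxHaar` (the tilt density is positive). -/
theorem aestronglyMeasurable_boxHaar_of_integrable {β : ℝ} {H : ℕ} {F : LGConfig 4 SU2 → ℝ}
    (hF : Integrable F (boxState (fundamentalRep (Fin 2)) β H)) : AEStronglyMeasurable F (boxHaar H) := by
  rw [boxState_eq_tilted] at hF
  exact hF.aestronglyMeasurable.mono_ac (absolutelyContinuous_tilted (integrable_exp_boxWilson β H))

end EdgeChart

open EdgeChart in
/-- ★★★ **T-S5.14 `BoxStateEdgeChart`, BY NAME.** -/
theorem boxStateEdgeChart : BoxStateEdgeChart := by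
  intro β H F hF
  have hFν := aestronglyMeasurable_boxHaar_of_integrable hF
  have hSc := continuous_exp_boxWilson β H
  have hint : AEStronglyMeasurable
      (fun U => (Real.exp (-β * boxWilson H U) / ∫ x, Real.exp (-β * boxWilson H x) ∂boxHaar H) • F U) (boxHaar H) :=
    ((hSc.div_const _).aestronglyMeasurable).smul hFν
  rw [boxState_eq_tilted, integral_tilted, integral_boxHaar_eq_chart H _ hint,
    integral_boxHaar_eq_chart H _ hSc.aestronglyMeasurable]
  simp_rw [neg_mul, smul_eq_mul]
  rw [← integral_div]
  congr 1
  funext a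
  ring

end Summit.QuantumFields.YangMills.Theorems.AllWindowsColdBoxBoxHighLine

end
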